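import Summits.ABC.ABC.Theses.CubicResolventAllowance

/-!
# SIGNPOST — `StubIdeas1Sketch.lean` (crux `IndexSzpiro`, stmt-ABC-22740)

Two stub-ideation seats, both numbered k=1 (one per stub of the registered skeleton), used this file
name on 2026-08-31 and the later write replaced the earlier one. Nothing is lost from the ledger, but the
in-tree copy must be disambiguated:

* `stub_complexCubic` · k=1 (gen 2) — the typed helpers referenced by `STUB-IDEAS-stub_complexCubic-1.md`
  (namespace `Summit.ABC.ABC.Cruxes.IndexSzpiro.StubIdeas1`; "rc 0; sorries only in the 7 proposals;
  9 helpers proved") are preserved as item evidence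
  `run/gate/evidence/stmt-ABC-22740/20260831T173225Z-StubIdeas1Sketch.lean` (`ledger workitem evidence
  latest stmt-ABC-22740 --name StubIdeas1Sketch.lean`). TO RESTORE in-tree: that seat (or the operator)
  re-publishes it, preferably as `StubIdeas1ComplexSketch.lean`, or back under this name.
* `stub_realCubic` · k=1 (gen 2) — typed helpers now live in `StubIdeas1RealSketch.lean`
  (namespace `Summit.ABC.ABC.Cruxes.IndexSzpiro.StubIdeas1Real`), referenced by
  `STUB-IDEAS-stub_realCubic-1.md` (rev 2).

This file intentionally declares nothing.
-/
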